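import Literature.NumberTheory.Automorphic.ArchInnerFormCartanAtlasRegular    -- ★ PART 2c (+ 2b, 2a): `gprimeTorus`, `boostStd_eq_conj_diagonal`, `injective_boostEig_iff`
import Literature.NumberTheory.Automorphic.ArchDiagonalTorusCentralizer      -- ★ `eq_diagonal_of_commute_circleDiagonal`
import HarnessLib

/-!
# The centraliser of a regular chart point of `G′_∞` is the chart torus ((T-ATLAS) PART 2d = (CENT-G); Rogawski 1990 §3.1, §3.6; Knapp 1986 V §3)

Topic `NumberTheory/Automorphic`; namespace `Literature.NumberTheory.Automorphic.UnitaryGroup`.  THEOREMS ONLY (no `def`, no instance, no notation, no axiom, no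
named fact, no `sorry`).  Cell `pub/hodgecm-mathlib`, crux H413 (`stmt-HodgeConjecture-24833`), F0∕P3c line LH3, DIRECT ROAD of `stub_N9`; seat LH3-p03 (g2); organ
(CENT-G) (PACK-SPEC v1 §1: `chartTorusG S′ = Z(gprimeTorus α S′ c)` at regular `c` — the identity (T-MEAS)'s chart Haar measure and (CUR)'s centraliser measures
`t′(γ′)` are compared through).  Count-neutral.

THE MATHEMATICS.  House frame `H′ = diagonal α` (`α_i ≠ 0`), `S′ ⊆ splitChartPlaces L α`, `c ∈ RegG S′`.  Let `g ∈ G′_∞` commute with `γ = gprimeTorus α S′ c`; place by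
place (★ `archPiEquivCM`):
* `w ∉ S′`: `γ_w = diag`-type with pairwise distinct unit eigenvalues, so `g_w` is diagonal (★ `eq_diagonal_of_commute_circleDiagonal`) and unitary for
  `diag(σ_w α)`, i.e. `|g_{w,ii}| = 1`: `g_w = gprimeCptGL τ (arg g_{w,τ k})_k`;
* `w ∈ S′`: in slot coordinates `γ_w = B = P·D·P⁻¹` (★ `boostStd_eq_conj_diagonal`, `D = diag(boostEig (c w))` with distinct entries since `x_w ≠ 0`), so
  `N = P⁻¹ g_w P` is diagonal (`eq_diagonal_of_commute_diagonal`); unitarity `g_wᴴ diag(b) g_w = diag(b)` read in the basis `P` (isotropic `v₀, v₂`, `K = Pᴴ diag(b) P`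
  with `K₀₂ = −2b₂`, `K₁₁ = b₁`) gives `n̄₀ n₂ = 1`, `|n₁| = 1`, whence `N = diag(boostEig (log ‖n₀‖, arg n₁, arg n₀))` and `g_w = B(b; x′, φ′, θ′)`
  (`exists_eq_boostStd_of_commute`).
Reassembling, **`g = gprimeTorus α S′ c′`** (`exists_eq_gprimeTorus_of_commute`); with ★ `gprimeTorus_comm`: **`g ∈ Z(gprimeTorus α S′ c) ↔ ∃ c′, g = gprimeTorus α S′ c′`**
(`mem_centralizer_gprimeTorus_iff`) — the chart torus is the full centraliser, in whichever spelling (`range` of the chart hom; its closure is redundant).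
* `eq_diagonal_of_commute_diagonal`, `exists_eq_boostStd_of_commute`, `exists_eq_gprimeSplitGL_of_commute`, `exists_eq_gprimeCptGL_of_commute`,
  **`exists_eq_gprimeTorus_of_commute`**, **`mem_centralizer_gprimeTorus_iff`**.
HONEST LABEL: HC_CM is proved only modulo the 7 printed citations (2 remaining: hLiu418 = `stmt-HodgeConjecture-24832`, h413 = `stmt-HodgeConjecture-24833`) until rung 0
closes; centraliser bookkeeping on the chart, count-neutral (+0∕+0).

## References
* [Rogawski1990] J. D. Rogawski, *Automorphic Representations of Unitary Groups in Three Variables*, Ann. of Math. Stud. 123 (1990), §3.1 p. 19 (regular elements and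
  their centralisers = Cartan subgroups), §3.6 p. 31.
* [Knapp1986] A. W. Knapp, *Representation Theory of Semisimple Groups* (1986), Ch. V §3 (the `MA` Cartan of `SU(2,1)`).
* [BrockerTomDieck1985] T. Bröcker, T. tom Dieck, *Representations of Compact Lie Groups* (1985), IV (2.3)(i) (a matrix commuting with a regular diagonal is diagonal).
-/

set_option autoImplicit false

noncomputable section

open NumberField NumberField.InfinitePlace NumberField.mixedEmbedding Matrix Complex
open scoped MatrixGroups Matrix ComplexConjugate Real Classical

namespace Literature.NumberTheory.Automorphic.UnitaryGroup

open Literature.NumberTheory.Rogawski1990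

/-! ## §1 Standard position: the commutant of a regular boost inside `U(diag b)(ℂ)` -/

section Standard

/-- **A matrix commuting with a diagonal matrix with pairwise-distinct entries is diagonal** (`M_{ij}(d_j − d_i) = 0`). [cite: BrockerTomDieck1985, IV (2.3)(i) (p0155)] -/
theorem eq_diagonal_of_commute_diagonal {N : ℕ} {d : Fin N → ℂ} (hd : Function.Injective d) {M : Matrix (Fin N) (Fin N) ℂ}
    (hM : M * Matrix.diagonal d = Matrix.diagonal d * M) : M = Matrix.diagonal fun i => M i i := by
  ext i j
  by_cases hij : i = j
  · subst hij; rw [Matrix.diagonal_apply_eq]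
  · rw [Matrix.diagonal_apply_ne _ hij]
    have h := congrFun (congrFun hM i) j
    rw [Matrix.mul_diagonal, Matrix.diagonal_mul] at h
    have hne : d j ≠ d i := fun e => hij (hd e).symm
    have h2 : M i j * (d j - d i) = 0 := by rw [mul_sub, h, mul_comm]; ring
    rcases mul_eq_zero.mp h2 with h3 | h3
    · exact h3
    · exact absurd (sub_eq_zero.mp h3) hne

/-- **The commutant of a regular boost in `U(diag b)(ℂ)` is the boost family**: if `M` commutes with `B(b; c)` (`b₀ b₂ < 0`, `b₁ ≠ 0`, `x = c 0 ≠ 0`) and preserves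
`diag(b)`, then `M = B(b; c′)` with `c′ = (log ‖n₀‖, arg n₁, arg n₀)` read off the eigenvalues `n` of `M` in the eigenbasis `cayB b`. [cite: Knapp1986, Ch. V §3]
[cite: Rogawski1990, §3.1 p. 19] -/
theorem exists_eq_boostStd_of_commute {b : Fin 3 → ℝ} (hb : b 0 * b 2 < 0) (hb1 : b 1 ≠ 0) {c : Fin 3 → ℝ} (hx : c 0 ≠ 0) {M : Matrix (Fin 3) (Fin 3) ℂ}
    (hM : M * boostStd b c = boostStd b c * M) (hU : Mᴴ * Matrix.diagonal (fun i => (b i : ℂ)) * M = Matrix.diagonal (fun i => (b i : ℂ))) :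
    ∃ c' : Fin 3 → ℝ, M = boostStd b c' := by
  set P : Matrix (Fin 3) (Fin 3) ℂ := cayB b with hP
  set D : Matrix (Fin 3) (Fin 3) ℂ := Matrix.diagonal (boostEig c) with hD
  set J : Matrix (Fin 3) (Fin 3) ℂ := Matrix.diagonal (fun i => (b i : ℂ)) with hJ
  have hu : IsUnit P.det := (det_cayB_ne_zero hb).isUnit
  have hB : boostStd b c = P * D * P⁻¹ := boostStd_eq_conj_diagonal hb c
  set N : Matrix (Fin 3) (Fin 3) ℂ := P⁻¹ * M * P with hN
  -- `N` commutes with `D`, hence is diagonal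
  have key : N * D = D * N := by
    have h1 : P⁻¹ * (M * boostStd b c) * P = P⁻¹ * (boostStd b c * M) * P := by rw [hM]
    rw [hB] at h1
    have e1 : P⁻¹ * (M * (P * D * P⁻¹)) * P = N * D := by
      rw [hN]; simp only [Matrix.mul_assoc]; rw [Matrix.nonsing_inv_mul _ hu, Matrix.mul_one]
    have e2 : P⁻¹ * (P * D * P⁻¹ * M) * P = D * N := by
      rw [hN]; simp only [Matrix.mul_assoc]; rw [Matrix.nonsing_inv_mul_cancel_left _ _ hu]
    rw [e1, e2] at h1
    exact h1
  have hNd : N = Matrix.diagonal fun i => N i i := eq_diagonal_of_commute_diagonal ((injective_boostEig_iff c).2 hx) key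
  -- `M = P N P⁻¹`, `M P = P N`
  have hMN : M = P * N * P⁻¹ := by
    rw [hN]; simp only [Matrix.mul_assoc]
    rw [Matrix.mul_nonsing_inv _ hu, Matrix.mul_one, Matrix.mul_nonsing_inv_cancel_left _ _ hu]
  have hMP : M * P = P * N := by
    rw [hMN]; simp only [Matrix.mul_assoc]; rw [Matrix.nonsing_inv_mul _ hu, Matrix.mul_one]
  -- unitarity in the eigenbasis: `Nᴴ K N = K`, `K = Pᴴ J P`
  have hK : Nᴴ * (Pᴴ * J * P) * N = Pᴴ * J * P := by
    calc Nᴴ * (Pᴴ * J * P) * N = (P * N)ᴴ * J * (P * N) := by rw [Matrix.conjTranspose_mul P N]; simp only [Matrix.mul_assoc]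
      _ = (M * P)ᴴ * J * (M * P) := by rw [hMP]
      _ = Pᴴ * (Mᴴ * J * M) * P := by rw [Matrix.conjTranspose_mul M P]; simp only [Matrix.mul_assoc]
      _ = Pᴴ * J * P := by rw [hU]
  -- the two entries of `K` that matter: `K₀₂ = −2 b₂`, `K₁₁ = b₁`
  have hb0 : b 0 ≠ 0 := fun h => by rw [h, zero_mul] at hb; exact lt_irrefl _ hb
  have hb2 : b 2 ≠ 0 := fun h => by rw [h, mul_zero] at hb; exact lt_irrefl _ hb
  have hr : ((Real.sqrt (-b 2 / b 0) : ℝ) : ℂ) ^ 2 * (b 0 : ℂ) = -(b 2 : ℂ) := by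
    have hq : 0 ≤ -b 2 / b 0 := by
      rcases lt_or_gt_of_ne hb0 with h | h
      · have : 0 < b 2 := by nlinarith
        exact le_of_lt (div_pos_of_neg_of_neg (by linarith) h)
      · have : b 2 < 0 := by nlinarith
        exact le_of_lt (div_pos (by linarith) h)
    have h : (Real.sqrt (-b 2 / b 0)) ^ 2 * b 0 = -b 2 := by rw [Real.sq_sqrt hq]; field_simp
    exact_mod_cast h
  have hK02 : (Pᴴ * J * P) 0 2 = -2 * (b 2 : ℂ) := by
    simp [hP, hJ, cayB, Matrix.mul_apply, Fin.sum_univ_three, Matrix.conjTranspose_apply, Matrix.diagonal_apply]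
    linear_combination hr
  have hK11 : (Pᴴ * J * P) 1 1 = (b 1 : ℂ) := by
    simp [hP, hJ, cayB, Matrix.mul_apply, Fin.sum_univ_three, Matrix.conjTranspose_apply, Matrix.diagonal_apply]
  -- entries of `Nᴴ K N` with `N` diagonal
  have hNKN : ∀ i j, (Nᴴ * (Pᴴ * J * P) * N) i j = (starRingEnd ℂ) (N i i) * (Pᴴ * J * P) i j * N j j := by
    intro i j
    rw [hNd, Matrix.diagonal_conjTranspose, Matrix.mul_diagonal, Matrix.diagonal_mul, Matrix.diagonal_apply_eq, Matrix.diagonal_apply_eq]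
    rfl
  have h02 : (starRingEnd ℂ) (N 0 0) * N 2 2 = 1 := by
    have h := hNKN 0 2
    rw [hK, hK02] at h
    have h' : ((starRingEnd ℂ) (N 0 0) * N 2 2 - 1) * (-2 * (b 2 : ℂ)) = 0 := by linear_combination -h
    rcases mul_eq_zero.1 h' with h1 | h1
    · exact sub_eq_zero.1 h1
    · exact absurd h1 (mul_ne_zero (by norm_num) (Complex.ofReal_ne_zero.2 hb2))
  have h11 : (starRingEnd ℂ) (N 1 1) * N 1 1 = 1 := by
    have h := hNKN 1 1
    rw [hK, hK11] at h
    have h' : ((starRingEnd ℂ) (N 1 1) * N 1 1 - 1) * (b 1 : ℂ) = 0 := by linear_combination -h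
    rcases mul_eq_zero.1 h' with h1 | h1
    · exact sub_eq_zero.1 h1
    · exact absurd h1 (Complex.ofReal_ne_zero.2 hb1)
  -- read off the coordinates
  have hn0 : N 0 0 ≠ 0 := by
    intro h0; rw [h0, map_zero, zero_mul] at h02; exact zero_ne_one h02
  have hnorm1 : ‖N 1 1‖ = 1 := by
    have h : ((‖N 1 1‖ : ℂ)) ^ 2 = 1 := by rw [← Complex.conj_mul', h11]
    have h' : ‖N 1 1‖ ^ 2 = 1 := by exact_mod_cast h
    exact (pow_eq_one_iff_of_nonneg (norm_nonneg _) two_ne_zero).1 h'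
  set x' : ℝ := Real.log ‖N 0 0‖
  set θ' : ℝ := Complex.arg (N 0 0)
  set φ' : ℝ := Complex.arg (N 1 1)
  have e0 : Complex.exp ((x' : ℂ) + (θ' : ℂ) * I) = N 0 0 := by
    rw [Complex.exp_add, ← Complex.ofReal_exp, Real.exp_log (norm_pos_iff.2 hn0)]
    exact Complex.norm_mul_exp_arg_mul_I (N 0 0)
  have e1 : Complex.exp ((φ' : ℂ) * I) = N 1 1 := by
    have h := Complex.norm_mul_exp_arg_mul_I (N 1 1)
    rwa [hnorm1, Complex.ofReal_one, one_mul] at h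
  have e2 : Complex.exp (-(x' : ℂ) + (θ' : ℂ) * I) = N 2 2 := by
    have hstar : (starRingEnd ℂ) (N 0 0) = Complex.exp ((x' : ℂ) - (θ' : ℂ) * I) := by
      rw [← e0, ← Complex.exp_conj, map_add, map_mul, Complex.conj_ofReal, Complex.conj_ofReal, Complex.conj_I]
      ring_nf
    have h22 : N 2 2 = ((starRingEnd ℂ) (N 0 0))⁻¹ := eq_inv_of_mul_eq_one_right h02
    rw [h22, hstar, ← Complex.exp_neg]
    congr 1
    ring
  have hEig : boostEig ![x', φ', θ'] = fun i => N i i := by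
    funext i
    fin_cases i
    · simpa [boostEig] using e0
    · simpa [boostEig] using e1
    · simpa [boostEig] using e2
  refine ⟨![x', φ', θ'], ?_⟩
  rw [boostStd_eq_conj_diagonal hb, ← hP, hEig, ← hNd, hMN]

end Standard

/-! ## §2 Place position: the commutant of a regular place component inside `G′_w` -/

section Place

variable (L : Type) [Field L] (α : Fin 3 → L) {w : {w : InfinitePlace L // IsComplex w}}

/-- **Split place**: an element of `G′_w = U(σ_w diag α)(ℂ)` commuting with the boost `gprimeSplitGL (lineOf s) a cw` (`x = cw 0 ≠ 0`, `w` a split-chart place of the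
house frame) IS a boost `gprimeSplitGL (lineOf s) a c′`. [cite: Knapp1986, Ch. V §3] [cite: Rogawski1990, §3.1 p. 19] -/
theorem exists_eq_gprimeSplitGL_of_commute (hα : ∀ i, α i ≠ 0) (hsp : w ∈ splitChartPlaces L α) {cw : Fin 3 → ℝ} (hx : cw 0 ≠ 0)
    (g : ↥(archLocal L 3 (Matrix.diagonal α) w))
    (hg : (g : GL (Fin 3) ℂ) * gprimeSplitGL (lineOf (formSign L α w)) (formRe L α w) cw = gprimeSplitGL (lineOf (formSign L α w)) (formRe L α w) cw * g) :
    ∃ c' : Fin 3 → ℝ, (g : GL (Fin 3) ℂ) = gprimeSplitGL (lineOf (formSign L α w)) (formRe L α w) c' := by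
  -- matrix-level commutation and unitarity, then pass to slot coordinates `M = G.submatrix τ τ`
  have hgM : ((g : GL (Fin 3) ℂ) : Matrix (Fin 3) (Fin 3) ℂ) * gprimeSplitMatrix (lineOf (formSign L α w)) (formRe L α w) cw =
      gprimeSplitMatrix (lineOf (formSign L α w)) (formRe L α w) cw * ((g : GL (Fin 3) ℂ) : Matrix (Fin 3) (Fin 3) ℂ) := by
    have h := congrArg (fun u : GL (Fin 3) ℂ => (u : Matrix (Fin 3) (Fin 3) ℂ)) hg
    simpa only [Units.val_mul, coe_gprimeSplitGL] using h
  have hU : ((g : GL (Fin 3) ℂ) : Matrix (Fin 3) (Fin 3) ℂ)ᴴ * Matrix.diagonal (fun i => (formRe L α w i : ℂ)) * ((g : GL (Fin 3) ℂ) : Matrix (Fin 3) (Fin 3) ℂ) =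
      Matrix.diagonal (fun i => (formRe L α w i : ℂ)) := by
    have h := (mem_archLocal_iff_conjTranspose L 3 (Matrix.diagonal α) w (g : GL (Fin 3) ℂ)).1 g.2
    rwa [diagonal_map_embedding_eq_of_real hsp.1] at h
  generalize hG : ((g : GL (Fin 3) ℂ) : Matrix (Fin 3) (Fin 3) ℂ) = G at hgM hU
  generalize hτ : lineOf (formSign L α w) = τ at hgM hsp ⊢
  generalize ha : formRe L α w = a at hgM hU hsp ⊢
  have ha1 : a (τ 1) ≠ 0 := by rw [← ha]; exact formRe_ne_zero hα hsp.1 (τ 1)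
  have hb : (a ∘ τ) 0 * (a ∘ τ) 2 < 0 := by have h := hsp.2; rw [hτ, ha] at h; exact h
  have hsub : ∀ X : Matrix (Fin 3) (Fin 3) ℂ, (X.submatrix τ.symm τ.symm).submatrix τ τ = X := fun X => by
    rw [Matrix.submatrix_submatrix, Equiv.symm_comp_self, Matrix.submatrix_id_id]
  have hMB : G.submatrix τ τ * boostStd (a ∘ τ) cw = boostStd (a ∘ τ) cw * G.submatrix τ τ := by
    have h := congrArg (fun X : Matrix (Fin 3) (Fin 3) ℂ => X.submatrix τ τ) hgM
    simp only [gprimeSplitMatrix] at h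
    rw [← Matrix.submatrix_mul_equiv G _ τ τ τ, ← Matrix.submatrix_mul_equiv _ G τ τ τ, hsub] at h
    exact h
  have hUM : (G.submatrix τ τ)ᴴ * Matrix.diagonal (fun i => ((a ∘ τ) i : ℂ)) * G.submatrix τ τ = Matrix.diagonal (fun i => ((a ∘ τ) i : ℂ)) := by
    have h := congrArg (fun X : Matrix (Fin 3) (Fin 3) ℂ => X.submatrix τ τ) hU
    rw [← Matrix.submatrix_mul_equiv _ G τ τ τ, ← Matrix.submatrix_mul_equiv Gᴴ _ τ τ τ, Matrix.submatrix_diagonal_equiv,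
      ← Matrix.conjTranspose_submatrix] at h
    exact h
  obtain ⟨c', hc'⟩ := exists_eq_boostStd_of_commute hb ha1 hx hMB hUM
  have hGM : G = (boostStd (a ∘ τ) c').submatrix τ.symm τ.symm := by
    rw [← hc', Matrix.submatrix_submatrix, Equiv.self_comp_symm, Matrix.submatrix_id_id]
  refine ⟨c', Matrix.GeneralLinearGroup.ext fun i j => ?_⟩
  rw [coe_gprimeSplitGL, gprimeSplitMatrix, hG, hGM]

/-- **Compact place**: an element of `G′_w` commuting with the unit diagonal `gprimeCptGL τ cw` with pairwise distinct eigenvalues IS some `gprimeCptGL τ c′`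
(diagonal by ★ `eq_diagonal_of_commute_circleDiagonal`, unit entries by unitarity for `diag(σ_w α)`, `α_i ≠ 0`). [cite: Rogawski1990, §3.1 p. 19]
[cite: BrockerTomDieck1985, IV (2.3)(i) (p0155)] -/
theorem exists_eq_gprimeCptGL_of_commute (hα : ∀ i, α i ≠ 0) (τ : Fin 3 ≃ Fin 3) {cw : Fin 3 → ℝ} (hinj : Function.Injective fun i : Fin 3 => Circle.exp (cw i))
    (g : ↥(archLocal L 3 (Matrix.diagonal α) w)) (hg : (g : GL (Fin 3) ℂ) * gprimeCptGL τ cw = gprimeCptGL τ cw * g) :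
    ∃ c' : Fin 3 → ℝ, (g : GL (Fin 3) ℂ) = gprimeCptGL τ c' := by
  have hz : Function.Injective (fun ℓ : Fin 3 => Circle.exp (cw (τ.symm ℓ))) := fun i j h => τ.symm.injective (hinj h)
  have hGd : ((g : GL (Fin 3) ℂ) : Matrix (Fin 3) (Fin 3) ℂ) = Matrix.diagonal fun i => ((g : GL (Fin 3) ℂ) : Matrix (Fin 3) (Fin 3) ℂ) i i := by
    refine eq_diagonal_of_commute_circleDiagonal 3 hz ?_
    have h := congrArg (fun u : GL (Fin 3) ℂ => (u : Matrix (Fin 3) (Fin 3) ℂ)) hg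
    simpa only [Units.val_mul, gprimeCptGL] using h
  have hU := (mem_archLocal_iff_conjTranspose L 3 (Matrix.diagonal α) w (g : GL (Fin 3) ℂ)).1 g.2
  rw [Matrix.diagonal_map (map_zero _)] at hU
  generalize hG : ((g : GL (Fin 3) ℂ) : Matrix (Fin 3) (Fin 3) ℂ) = G at hGd hU
  have hnorm : ∀ i, ‖G i i‖ = 1 := by
    intro i
    have h := congrFun (congrFun hU i) i
    rw [hGd, Matrix.diagonal_conjTranspose, Matrix.diagonal_mul_diagonal, Matrix.diagonal_mul_diagonal, Matrix.diagonal_apply_eq,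
      Matrix.diagonal_apply_eq] at h
    have he : w.1.embedding (α i) ≠ 0 := (_root_.map_ne_zero _).2 (hα i)
    have h2 : (starRingEnd ℂ) (G i i) * G i i = 1 := by
      have h' : ((starRingEnd ℂ) (G i i) * G i i - 1) * w.1.embedding (α i) = 0 := by
        have hs : (star fun i => G i i) i = (starRingEnd ℂ) (G i i) := rfl
        rw [hs] at h
        linear_combination h
      rcases mul_eq_zero.1 h' with h1 | h1
      · exact sub_eq_zero.1 h1
      · exact absurd h1 he
    have h3 : ((‖G i i‖ : ℂ)) ^ 2 = 1 := by rw [← Complex.conj_mul', h2]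
    have h4 : ‖G i i‖ ^ 2 = 1 := by exact_mod_cast h3
    exact (pow_eq_one_iff_of_nonneg (norm_nonneg _) two_ne_zero).1 h4
  refine ⟨fun k => Complex.arg (G (τ k) (τ k)), Matrix.GeneralLinearGroup.ext fun i j => ?_⟩
  rw [coe_gprimeCptGL, hG]
  conv_lhs => rw [hGd]
  by_cases hij : i = j
  · subst hij
    rw [Matrix.diagonal_apply_eq, Matrix.diagonal_apply_eq, Equiv.apply_symm_apply]
    have h := Complex.norm_mul_exp_arg_mul_I (G i i)
    rw [hnorm i, Complex.ofReal_one, one_mul] at h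
    exact h.symm
  · rw [Matrix.diagonal_apply_ne _ hij, Matrix.diagonal_apply_ne _ hij]

end Place

/-! ## §3 The centraliser of a regular chart point -/

section Charts

variable (L : Type) [Field L] [NumberField L] [IsCMField L] (α : Fin 3 → L) (S' : Finset {w : InfinitePlace L // IsComplex w})

/-- **`Z_{G′_∞}(gprimeTorus α S′ c) ⊆` chart torus** at a regular chart point: every `g ∈ G′_∞` commuting with `gprimeTorus α S′ c` (`S′ ⊆` split-chart places,
`c ∈ RegG S′`, house frame `α_i ≠ 0`) is `gprimeTorus α S′ c′` for some `c′`. [cite: Rogawski1990, §3.1 p. 19; §3.6 p. 31] -/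
theorem exists_eq_gprimeTorus_of_commute (hα : ∀ i, α i ≠ 0) (hS' : ∀ w, w ∈ S' → w ∈ splitChartPlaces L α)
    {c : {w : InfinitePlace L // IsComplex w} → Fin 3 → ℝ} (hc : c ∈ ArchCartan.RegG S')
    (g : ↥(arch (↥(maximalRealSubfield L)) L (IsCMField.complexConj L) 3 (Matrix.diagonal α)))
    (hg : g * gprimeTorus L α S' c = gprimeTorus L α S' c * g) :
    ∃ c' : {w : InfinitePlace L // IsComplex w} → Fin 3 → ℝ, g = gprimeTorus L α S' c' := by
  rw [ArchCartan.mem_regG_iff] at hc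
  have key : ∀ w : {w : InfinitePlace L // IsComplex w}, ∃ cw' : Fin 3 → ℝ,
      ((archPiEquivCM 3 L (Matrix.diagonal α) g w : ↥(archLocal L 3 (Matrix.diagonal α) w)) : GL (Fin 3) ℂ) =
        ((gprimeBlock L α w S' (fun _ => cw') : ↥(archLocal L 3 (Matrix.diagonal α) w)) : GL (Fin 3) ℂ) := by
    intro w
    have hgw := congrArg (fun x : arch (↥(maximalRealSubfield L)) L (IsCMField.complexConj L) 3 (Matrix.diagonal α) =>
      ((archPiEquivCM 3 L (Matrix.diagonal α) x w : ↥(archLocal L 3 (Matrix.diagonal α) w)) : GL (Fin 3) ℂ)) hg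
    simp only [map_mul, Pi.mul_apply, Subgroup.coe_mul, archPiEquivCM_gprimeTorus] at hgw
    by_cases hw : w ∈ S'
    · rw [coe_gprimeBlock_of_mem L α c hw (hS' w hw)] at hgw
      obtain ⟨cw', h⟩ := exists_eq_gprimeSplitGL_of_commute L α hα (hS' w hw) (hc.2 w hw) _ hgw
      exact ⟨cw', by rw [h, coe_gprimeBlock_of_mem L α _ hw (hS' w hw)]⟩
    · rw [coe_gprimeBlock_of_not_mem L α c hw] at hgw
      obtain ⟨cw', h⟩ := exists_eq_gprimeCptGL_of_commute L α hα _ (hc.1 w hw) _ hgw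
      exact ⟨cw', by rw [h, coe_gprimeBlock_of_not_mem L α _ hw]⟩
  choose c' hc' using key
  refine ⟨c', (archPiEquivCM 3 L (Matrix.diagonal α)).injective ?_⟩
  rw [gprimeTorus, ContinuousMulEquiv.apply_symm_apply]
  funext w
  apply Subtype.ext
  rw [hc' w]
  by_cases hw : w ∈ S'
  · by_cases hsp : w ∈ splitChartPlaces L α
    · rw [coe_gprimeBlock_of_mem L α _ hw hsp, coe_gprimeBlock_of_mem L α _ hw hsp]
    · rw [coe_gprimeBlock_of_not_mem_splitChartPlaces L α _ hsp, coe_gprimeBlock_of_not_mem_splitChartPlaces L α _ hsp]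
  · rw [coe_gprimeBlock_of_not_mem L α _ hw, coe_gprimeBlock_of_not_mem L α _ hw]

/-- **THE CENTRALISER OF A REGULAR CHART POINT IS THE CHART TORUS**: `g ∈ Z_{G′_∞}(gprimeTorus α S′ c) ↔ ∃ c′, g = gprimeTorus α S′ c′` (`S′ ⊆` split-chart
places, `c ∈ RegG S′`, `α_i ≠ 0`) — so `Z(γ) = range` of the chart homomorphism (★ `gprimeTorus_add`), the `chartTorusG S′` of PACK-SPEC §1 in either spelling.
[cite: Rogawski1990, §3.1 p. 19; §3.6 p. 31] -/
theorem mem_centralizer_gprimeTorus_iff (hα : ∀ i, α i ≠ 0) (hS' : ∀ w, w ∈ S' → w ∈ splitChartPlaces L α)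
    {c : {w : InfinitePlace L // IsComplex w} → Fin 3 → ℝ} (hc : c ∈ ArchCartan.RegG S')
    (g : ↥(arch (↥(maximalRealSubfield L)) L (IsCMField.complexConj L) 3 (Matrix.diagonal α))) :
    g ∈ Subgroup.centralizer ({gprimeTorus L α S' c} : Set ↥(arch (↥(maximalRealSubfield L)) L (IsCMField.complexConj L) 3 (Matrix.diagonal α))) ↔
      ∃ c' : {w : InfinitePlace L // IsComplex w} → Fin 3 → ℝ, g = gprimeTorus L α S' c' := by
  rw [Subgroup.mem_centralizer_singleton_iff]
  constructor
  · intro h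
    exact exists_eq_gprimeTorus_of_commute L α S' hα hS' hc g h
  · rintro ⟨c', rfl⟩
    exact gprimeTorus_comm L α S' c' c

/-- The centralisers of any two regular chart points of the same chart coincide (both are the chart torus) — ONE Haar measure on the chart torus serves every regular
point. [cite: Rogawski1990, §3.1 p. 19] -/
theorem centralizer_gprimeTorus_eq_centralizer (hα : ∀ i, α i ≠ 0) (hS' : ∀ w, w ∈ S' → w ∈ splitChartPlaces L α)
    {c₁ c₂ : {w : InfinitePlace L // IsComplex w} → Fin 3 → ℝ} (h₁ : c₁ ∈ ArchCartan.RegG S') (h₂ : c₂ ∈ ArchCartan.RegG S') :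
    Subgroup.centralizer ({gprimeTorus L α S' c₁} : Set ↥(arch (↥(maximalRealSubfield L)) L (IsCMField.complexConj L) 3 (Matrix.diagonal α))) =
      Subgroup.centralizer ({gprimeTorus L α S' c₂} : Set ↥(arch (↥(maximalRealSubfield L)) L (IsCMField.complexConj L) 3 (Matrix.diagonal α))) := by
  ext g
  rw [mem_centralizer_gprimeTorus_iff L α S' hα hS' h₁, mem_centralizer_gprimeTorus_iff L α S' hα hS' h₂]

/-- Every chart point lies in the centraliser of every regular chart point. [cite: Rogawski1990, §3.1 p. 19] -/
theorem gprimeTorus_mem_centralizer (c c' : {w : InfinitePlace L // IsComplex w} → Fin 3 → ℝ) :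
    gprimeTorus L α S' c' ∈ Subgroup.centralizer ({gprimeTorus L α S' c} : Set ↥(arch (↥(maximalRealSubfield L)) L (IsCMField.complexConj L) 3 (Matrix.diagonal α))) := by
  rw [Subgroup.mem_centralizer_singleton_iff]
  exact gprimeTorus_comm L α S' c' c

end Charts

end Literature.NumberTheory.Automorphic.UnitaryGroup

end
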